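import Literature.AnabelianGeometry.AbsoluteAnabelian.ArchimedeanHolFieldFunctorGeometricPSLLambdaRoot
import Literature.AnabelianGeometry.AbsoluteAnabelian.ArchimedeanHolFieldFunctorGeometricPSLGenuineBases
import HarnessLib

/-!
# [AbsTopIII] Prop 4.2 (i) and Cor 4.5 at the GENUINE plane domains `ℂ ∖ ({0} ∪ 16^{-1/N} μ_N)` — zero hypotheses (PROOF-ONLY)

abc-iut cell, row «LAMBDA-ROOT-BASES» part 2 (lineage abc-iut-L4-d1) — the CAPSTONE over part 1
(`…PSLLambdaRoot.lean`: `ℍ/Γ̄_N ≅ ℂ ∖ F_N` by `x_N = (λ/16)^{1/N}`, `Γ̄_N = π(Λ_N)` arithmetic and free of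
rank `|F_N| ≥ 2`) and abc-iut-L4-t14's arithmetic closers (`…PSLGenuineBases.lean`:
`isIdRigid_EA_mapsTo_pslQuotient_of_isArithmetic_hfinFree` & Co., themselves over abc-iut-L4-d1's
(P)/(FC)-from-arithmeticity `…PSLArithmeticCusps.lean`).  S. Mochizuki, *Topics in Absolute Anabelian
Geometry III*, Def. 4.1 (i) p. 101, proof of Prop. 4.2 (i) p. 106, Cor. 4.5 pp. 107–109.

For every `N ≥ 1`, at the GENUINE Riemann surface `X_N = ℂ ∖ F_N`, `F_N = {0} ∪ {u | 16 uᴺ = 1}` (a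
hyperbolic curve of type `(0, N + 2)`; `N = 1` is the tripod up to `u ↦ 16 u`):

* §1 the binders at `Γ̄_N`: `isArithmetic_pslLambdaRootDeck` (via abc-iut-L4-t12's
  `isArithmetic_map_comap_of_subgroup_SL2Z` and part 1's `finiteIndex_modularLambdaRootDeck`),
  `isFreeOrSurface_pslLambdaRootDeck`, `exists_mul_ne_mul_pslLambdaRootDeck`;
* §2 ★★★ `isIdRigid_EA_mapsTo_lambdaRootPlane` — **the geometric `EA` of connected Riemann surfaces
  mapping to `X_N` is ID-RIGID** (Prop 4.2 (i) at `X = X_N`), ★★★ `cor_4_5_geometric_mapsTo_lambdaRootPlane`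
  — **Cor 4.5 (i)–(v) AS TYPED**, and the print-faithful RC twins
  `RC.isIdRigid_EA_mapsTo_lambdaRootPlane`, `RC.cor_4_5_geometric_mapsTo_lambdaRootPlane` — all with
  NO hypothesis (beyond `N ≠ 0`).

No definitions, no instances, no named facts.  HONEST FRAMING: an infinite family of genuine ARITHMETIC
plane-domain bases (the quotients by the Fermat groups); no `(1, 1)` curve is reached this way; MODEL side
of [AbsTopIII] §4 — model ≠ reconstruction; classical (Calegari–Dimitrov–Tang 2025 §3; Farkas–Kra IV.5);
nothing here bears on the disputed [IUTchIII] Cor. 3.12.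

## References

* S. Mochizuki, *Topics in Absolute Anabelian Geometry III* (2015), Def. 4.1 (i) p. 101, proof of
  Prop. 4.2 (i) p. 106, Cor. 4.5 pp. 107–109. [MochizukiAbsTopIII2015]
* G. Shimura, *Introduction to the Arithmetic Theory of Automorphic Functions* (1971), §1.5. [Shimura1971]
* R. C. Lyndon, P. E. Schupp, *Combinatorial Group Theory* (2001), Ch. I. [LyndonSchupp2001]
-/

set_option autoImplicit false

noncomputable section

open scoped UpperHalfPlane MatrixGroups
open _root_.MulAction _root_.CategoryTheory
open Matrix.SpecialLinearGroup (toGL)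
open Literature.IUT.HodgeTheaters (IsFreeOrSurface IsFreeOfFiniteRank)

namespace Literature.AnabelianGeometry.AbsoluteAnabelian

namespace HolRS

open Literature.NumberTheory.Automorphic.ModularLambda (modularLambdaRootDeck)

/-! ### §1 The binders of the geometric column at `Γ̄_N` -/

/-- `Γ̄_N` is ARITHMETIC: `toGL(π⁻¹ Γ̄_N)` is an arithmetic subgroup of `GL(2, ℝ)` (abc-iut-L4-t12's
`isArithmetic_map_comap_of_subgroup_SL2Z` over `finiteIndex_modularLambdaRootDeck`).
[cite: Shimura1971, §1.5] -/
theorem isArithmetic_pslLambdaRootDeck {N : ℕ} (hN : N ≠ 0) :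
    (((((modularLambdaRootDeck N).map (Matrix.SpecialLinearGroup.map (Int.castRingHom ℝ))).map
        (QuotientGroup.mk' (Subgroup.center SL(2, ℝ)))).comap
        (QuotientGroup.mk' (Subgroup.center SL(2, ℝ)))).map
      (toGL : SL(2, ℝ) →* GL (Fin 2) ℝ)).IsArithmetic := by
  haveI := finiteIndex_modularLambdaRootDeck hN
  exact isArithmetic_map_comap_of_subgroup_SL2Z (modularLambdaRootDeck N)

/-- `Γ̄_N` is free of finite rank (`≃* FreeGroup (Fin |F_N|)`), hence «free-or-surface».
[cite: LyndonSchupp2001, Ch. I Prop. 2.7] -/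
theorem isFreeOrSurface_pslLambdaRootDeck {N : ℕ} (hN : N ≠ 0) :
    IsFreeOrSurface (((modularLambdaRootDeck N).map (Matrix.SpecialLinearGroup.map (Int.castRingHom ℝ))).map
        (QuotientGroup.mk' (Subgroup.center SL(2, ℝ)))) := by
  obtain ⟨-, -, -, -, ⟨e⟩, -⟩ := pslLambdaRootDeck_uniformisation hN
  exact Or.inl ⟨_, ⟨e⟩⟩

/-- `Γ̄_N` is non-abelian (free of rank `|F_N| ≥ 2`). [cite: LyndonSchupp2001, Ch. I Prop. 2.16] -/
theorem exists_mul_ne_mul_pslLambdaRootDeck {N : ℕ} (hN : N ≠ 0) :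
    ∃ a b : (((modularLambdaRootDeck N).map (Matrix.SpecialLinearGroup.map (Int.castRingHom ℝ))).map
        (QuotientGroup.mk' (Subgroup.center SL(2, ℝ)))), a * b ≠ b * a := by
  obtain ⟨-, -, -, -, ⟨e⟩, -⟩ := pslLambdaRootDeck_uniformisation hN
  exact Literature.GroupTheory.exists_mul_ne_mul_of_mulEquiv e
    (Literature.GroupTheory.FreeGroup.exists_mul_ne_mul_fin (two_le_ncard_lambdaRootCusps hN))

/-! ### §2 Prop 4.2 (i) and Cor 4.5 at `X_N = ℂ ∖ F_N`, zero hypotheses -/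

/-- ★★★ **[AbsTopIII] Prop 4.2 (i) AT THE GENUINE PLANE DOMAIN `X_N = ℂ ∖ ({0} ∪ 16^{-1/N} μ_N)`,
every `N ≥ 1`, ZERO HYPOTHESES**: the geometric `EA` of connected Riemann surfaces mapping to `X_N` is
ID-RIGID.  Assembly: `X_N ≅ ℍ/Γ̄_N` by `x_N` (`pslLambdaRootDeck_uniformisation`); `Γ̄_N` arithmetic, free
of finite rank `≥ 2`, acting freely and properly discontinuously; abc-iut-L4-t14's
`isIdRigid_EA_mapsTo_pslQuotient_of_isArithmetic_hfinFree`; transport along «maps to `ℍ/Γ̄_N`» =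
«maps to `X_N`». [cite: MochizukiAbsTopIII2015, Proposition 4.2 (i) proof p.106] -/
theorem isIdRigid_EA_mapsTo_lambdaRootPlane {N : ℕ} (hN : N ≠ 0) :
    IsIdRigid (geometricAutHolFieldFunctor fun Y : HolRS => Nonempty (Y ⟶
      planeComplFinite (insert (0 : ℂ) {u : ℂ | 16 * u ^ N = 1}) (finite_lambdaRootCusps hN))).EA := by
  obtain ⟨hPD, hC, -, -, -, -, hH, -⟩ := pslLambdaRootDeck_uniformisation hN
  haveI := hPD
  haveI := hC
  haveI := isArithmetic_pslLambdaRootDeck hN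
  have h := isIdRigid_EA_mapsTo_pslQuotient_of_isArithmetic_hfinFree _
    (isFreeOrSurface_pslLambdaRootDeck hN) (exists_mul_ne_mul_pslLambdaRootDeck hN)
  rw [hH] at h
  exact h

/-- ★★★ **[AbsTopIII] Cor 4.5 (i)–(v) AT `X_N = ℂ ∖ ({0} ∪ 16^{-1/N} μ_N)`, every `N ≥ 1`, ZERO
HYPOTHESES.** [cite: MochizukiAbsTopIII2015, Corollary 4.5 pp.107–109] -/
theorem cor_4_5_geometric_mapsTo_lambdaRootPlane {N : ℕ} (hN : N ≠ 0) :
    Literature.AnabelianGeometry.AbsoluteAnabelian.AbsTopIII.Cor_4_5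
      (archLogFrobeniusData (geometricAutHolFieldFunctor fun Y : HolRS => Nonempty (Y ⟶
        planeComplFinite (insert (0 : ℂ) {u : ℂ | 16 * u ^ N = 1}) (finite_lambdaRootCusps hN))))
      (archTelecoreData (geometricAutHolFieldFunctor fun Y : HolRS => Nonempty (Y ⟶
        planeComplFinite (insert (0 : ℂ) {u : ℂ | 16 * u ^ N = 1}) (finite_lambdaRootCusps hN)))) := by
  obtain ⟨hPD, hC, -, -, -, -, hH, -⟩ := pslLambdaRootDeck_uniformisation hN
  haveI := hPD
  haveI := hC
  haveI := isArithmetic_pslLambdaRootDeck hN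
  have h := cor_4_5_geometric_mapsTo_pslQuotient_of_isArithmetic_hfinFree _
    (isFreeOrSurface_pslLambdaRootDeck hN) (exists_mul_ne_mul_pslLambdaRootDeck hN)
  rw [hH] at h
  exact h

/-- ★★★ **Prop 4.2 (i) at `X_N`, PRINT-FAITHFUL (RC) morphisms, ZERO HYPOTHESES.**
[cite: MochizukiAbsTopIII2015, Proposition 4.2 (i) proof p.106] -/
theorem RC.isIdRigid_EA_mapsTo_lambdaRootPlane {N : ℕ} (hN : N ≠ 0) :
    IsIdRigid (geometricAutHolFieldFunctorRC fun Y : RC => Nonempty (Y ⟶ toRC.obj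
      (planeComplFinite (insert (0 : ℂ) {u : ℂ | 16 * u ^ N = 1}) (finite_lambdaRootCusps hN)))).EA := by
  obtain ⟨hPD, hC, -, -, -, -, -, hR⟩ := pslLambdaRootDeck_uniformisation hN
  haveI := hPD
  haveI := hC
  haveI := isArithmetic_pslLambdaRootDeck hN
  have h := RC.isIdRigid_EA_mapsTo_pslQuotient_of_isArithmetic_hfinFree _
    (isFreeOrSurface_pslLambdaRootDeck hN) (exists_mul_ne_mul_pslLambdaRootDeck hN)
  rw [hR] at h
  exact h

/-- ★★★ **Cor 4.5 (i)–(v) at `X_N`, PRINT-FAITHFUL (RC) morphisms, ZERO HYPOTHESES.**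
[cite: MochizukiAbsTopIII2015, Corollary 4.5 pp.107–109] -/
theorem RC.cor_4_5_geometric_mapsTo_lambdaRootPlane {N : ℕ} (hN : N ≠ 0) :
    Literature.AnabelianGeometry.AbsoluteAnabelian.AbsTopIII.Cor_4_5
      (archLogFrobeniusData (geometricAutHolFieldFunctorRC fun Y : RC => Nonempty (Y ⟶ toRC.obj
        (planeComplFinite (insert (0 : ℂ) {u : ℂ | 16 * u ^ N = 1}) (finite_lambdaRootCusps hN)))))
      (archTelecoreData (geometricAutHolFieldFunctorRC fun Y : RC => Nonempty (Y ⟶ toRC.obj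
        (planeComplFinite (insert (0 : ℂ) {u : ℂ | 16 * u ^ N = 1}) (finite_lambdaRootCusps hN))))) := by
  obtain ⟨hPD, hC, -, -, -, -, -, hR⟩ := pslLambdaRootDeck_uniformisation hN
  haveI := hPD
  haveI := hC
  haveI := isArithmetic_pslLambdaRootDeck hN
  have h := RC.cor_4_5_geometric_mapsTo_pslQuotient_of_isArithmetic_hfinFree _
    (isFreeOrSurface_pslLambdaRootDeck hN) (exists_mul_ne_mul_pslLambdaRootDeck hN)
  rw [hR] at h
  exact h

end HolRS

end Literature.AnabelianGeometry.AbsoluteAnabelian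

end

-- tree-health (abc-iut-w6-d081 g5, 2026-08-27T01:12Z): comment-only re-land of a SKIPPED ACCEPT (p475103 accepted 2026-08-26T23:30:39Z; serial farm import probe at 01:07Z answers rc 75 «remote:stale:1011:unbuilt», 97 min, while the lane builds p90 < 6 min);
-- declarations byte-identical to the accepted version; purpose = trigger the rebuild. No content change.
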